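import Mathlib
import HarnessLib
import HarnessLib.Audit
import Summits.NavierStokesRegularity.Statement
import Literature.Analysis.FluidPDE.ClassicalSolution
import Literature.Analysis.FluidPDE.LerayHopf
import Literature.Analysis.FluidPDE.NSWave0
import Literature.Analysis.FluidPDE.SuitableWeak
import Literature.Analysis.FluidPDE.SelfSimilar
import Literature.Analysis.FluidPDE.LocalTypeI
import Literature.Analysis.FluidPDE.VectorCalculus
import Literature.Analysis.FluidPDE.Vorticity
import Literature.Analysis.FluidPDE.VorticityCalculus
import Literature.Analysis.FluidPDE.TaoEnstrophyLocalisation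
import Literature.Analysis.FluidPDE.SereginSverak2002PressureLowerBound
import Literature.Analysis.FluidPDE.NSBoundedMildOseen
import Literature.Analysis.UnboundedOperators.HeatKernel
import HarnessLib.Audit.Status.Attr

/-!
Route: LocalOneDirectionTubeDoor

CLOSED (proved) 2026-08-27T06:20:23Z by planner-director-ns-g7-0 — reason: proved:Summit.NavierStokesRegularity.NavierStokesRegularity.Theorems.LocalOneDirectionTubeDoorTarget.target_proof_direct — note: director-ns g7 (D-0092): rung N0-LocalTubeDoorOneDirection CLOSED·PROVED — capstone target_proof_direct (p503438, := localTubeDoorOneDirection p456214, std axioms); items 20266 ← p503440, 20265 ← p503437, 20267 ← p503435, 20264 ← p503438 (nsreg-p6 g8); tribunal r1 passed·frontier (T1 82f9909c / T2 b. The file is kept as the record of this route; refuted decls are indexed as negative knowledge (`ledger negatives`).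

# Route LocalOneDirectionTubeDoor — local Type I plus a fading DIRECTIONAL DERIVATIVE ∂ₑu over one
similarity window forces regularity — via velocity-gradient zoom and triviality of
translation-invariant Type-I profiles

RUNG-LEAF ROUTE (D-0061; leaf = the proposed rung N0-LocalTubeDoorOneDirection of LADDER-NS = this
route's own `Target` item, the ONE-DIRECTION-DERIVATIVE (local two-dimensionalisation) WINDOW DOOR
S13 of cell ns-regularity-ideate; it does NOT claim Clay (A)). It suffices to show X = K1 ∧ K2 where
K1 = LocalPointZoomVelGradSlices: at a point x₀ where a classical Leray–Hopf flow is LOCALLY Type I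
(one parabolic cylinder) but not backward bounded, some zoom sequence λ_j → 0⁺ of unit-viscosity
rescalings (λ_j/ν)·u(T + λ_j²s/ν, x₀ + λ_j y), TOGETHER WITH their gradients (λ_j²/ν)·∇u, converges
pointwise at EVERY slice s < 0 to a Type-I-rate, continuous, Oseen-mild, divergence-free profile v
on (−∞,0) × ℝ³ with backward-singular apex (tree theorem `localPointZoomVelGradSlices`, p441522);
and K2 = OneDirectionWindowRigidity: such a profile has continuous velocity-gradient slices and
cannot have, for a fixed e ≠ 0, on every slice a nonempty open set where ∂ₑv(s,·) vanishes, unless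
its apex is regular (tree theorems `windowCrux_dirDerivNorm` / `oneSliceCrux_dirDerivNorm`, p456214:
∂ₑv(s) = 0 on a window of ONE slice spreads to the slice by analyticity, the slice is then invariant
under translations along e (mean value theorem), and translation-invariant Type-I profiles are
trivial by the ancient planar Liouville theorem with the Type-I rate, tree
`eq_zero_of_translate_eq_slice`). The leaf follows by the scale-critical limit passage proved in
glue.lean (`closes`, kernel-checked against a mock of this file): along the zoom times t_j = T +
λ_j² s/ν the window gradient is (σ²ν)·[zoom gradient](σy), σ = √(−s)/√ν, so Fatou turns the
L¹(U)-fading of (T−t)‖∂ₑu‖ into ‖∂ₑv(s)(σy)‖ = 0 on U, i.e. ∂ₑv(s) vanishes on the open window σ•U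
of every slice, and K2 contradicts the singular apex.
Lean:
`Summit.NavierStokesRegularity.NavierStokesRegularity.Theses.LocalOneDirectionTubeDoor.LocalPointZoomVelGradSlices
∧
Summit.NavierStokesRegularity.NavierStokesRegularity.Theses.LocalOneDirectionTubeDoor.OneDirectionWindowRigidity`

## Assembly
An elementary limit passage (glue.lean, one theorem `closes`, ≈ 160 lines, Literature-only imports,
kernel-checked against the mock HOME/ns-regularity-ideate-p6/s13-onedirection-birth/MockS13.lean,
farm rc 0 / 0 sorries): fix the frame data, e ≠ 0, a window U and the fading hypothesis; rewrite the
integrand (T−t)‖∂ₑu‖ as |F(√(T−t)u, (T−t)∇u)| with F(x, A) = ‖A e‖; suppose x₀ is not backward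
bounded; K1 gives (C, v, λ_j) with slice-wise pointwise convergence of rescaled velocities and
gradients; K2(i) gives continuity of every gradient slice. Fix s < 0 and zoom along t_j = T + λ_j²
s/ν → T⁻ (eventually in (0,T), where u(t_j) is smooth, so the window fields are continuous): the
window gradient equals (σ²ν)·[zoom gradient](σy), σ = √(−s)/√ν, so F(window) converges pointwise to
‖(σ²ν)∇v(s)(σy) e‖; Fatou (`lintegral_liminf_le'`) and the fading give ∫_U of the limit = 0; the
limit integrand is continuous and nonnegative, hence zero on the open set U; undoing the scaling
gives ∂ₑv(s)(z) = 0 on the nonempty open set σ•U. This holds for every s < 0, so K2(ii) says the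
apex is not singular — contradicting K1. (The deciding theorem is `closes`; the Assembly item below
only records the shape.)

CLOSES_TARGET: closes rung N0-LocalTubeDoorOneDirection of NavierStokesRegularity: Summit.NavierStokesRegularity.NavierStokesRegularity.Theses.LocalOneDirectionTubeDoor.Target (D-0061; not the summit Statement) — the deciding theorem of this route concludes that registered leaf instead of the Statement decl `NavierStokesRegularity` (class rung: servable and labelled, never counted as concluding the summit Statement).

Rationale: WHY THIS LINE. The door reads ONE DIRECTIONAL DERIVATIVE ∂ₑu of the velocity (e ≠ 0 fixed) — local
TWO-DIMENSIONALISATION of the flow along e — scale-normalised as (T−t)∂ₑu on ONE similarity window,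
where the sibling doors read the vorticity direction (LocalSineTubeDoor, CLOSED), one velocity
component (LocalVelCompTubeDoor, CLOSED), the Lamb vector (LocalLambTubeDoor, staged S12), one
vorticity component (PoloidalWindowDoor, K2 open) or the helicity density (LocalTubeDoorHelicity,
staged, K2⁗ open). Its engine: on the zoom limit, ∂ₑv(s) vanishes on a window of a slice, hence on
the whole slice (real analyticity of Oseen-mild bounded ancient slices), so the slice is invariant
under translations along e (mean value theorem on the lines y + ℝe; tree
`translate_eq_of_fderiv_apply_eq_zero`), and translation invariance of ONE slice already forces v ≡
0 in the Type-I ancient mild class (tree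
`…PoloidalWindowRigidityOneSlice.eq_zero_of_translate_eq_slice`, p433678: forward/backward
propagation of the symmetry by bounded-mild uniqueness and analyticity, then the ancient planar
Liouville theorem (N₁) with the Type-I rate, tree `KNSS2009_typeI_rate_liouville_holds`). Imported:
the blow-up zoom of Albritton–Barker arXiv:1811.00502 (tree universal first-order zoom p441522),
KNSS 2009 arXiv:0709.3599 Thm 5.1/6.2 (planar Liouville with rate). In print, ONE-DIRECTION
regularity criteria are integrability conditions: GLOBAL ∂₃u ∈ L^p_tL^q_x (Kukavica–Ziane 2007 JMP,
Cao–Titi 2011) and the LOCAL version of Kukavica–Rusin–Ziane 2019 (Nonlinearity,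
doi:10.1088/1361-6544/aaea0a: ∂₃u ∈ L^p_tL^q_x(D), 2/p + 3/q = 2, 9/4 ≤ q ≤ 5/2, suitable weak ⇒
Hölder regular in D); the window-FADING criterion under LOCAL Type I (an o(1) condition on a
vanishing similarity tube, along sparse times in the sequential/most-times forms p456214) and the
one-slice profile statement are not among them. What it does that the cell's other routes do not:
BOTH cruxes are TREE THEOREMS (K1 = p441522 verbatim; K2 = p456214 plus the continuity clause by
slice analyticity), so the route is born moot-by-proof — a kernel-closed N0 door whose hypothesis is
a partial SYMMETRY (translation along e) emerging on one window.

RANKED CRUXES. #0 Target (target) — the leaf LocalTubeDoorOneDirection: classical NS solution on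
[0,T), Leray–Hopf from a rapidly decaying datum, locally Type I at (x₀,T) on B(x₀,ρ) × ((T−ρ²)∨0,
T); if for ONE fixed e ≠ 0 and ONE nonempty open window U of similarity coordinates the
scale-normalised directional derivative fades in L¹, ∫_U (T−t) ‖∂ₑu(t, x₀+√(T−t)y)‖ dy → 0 as t →
T⁻, then u is backward bounded at (x₀,T). (= statement of the tree theorem
`…Theorems.LocalSineTubeDoorOneDirectionDoor.localTubeDoorOneDirection`, p456214, verbatim.) (why it
might fail: it cannot — the statement is the tree theorem `localTubeDoorOneDirection` (p456214); the
route records it as a rung leaf with its two cruxes by name. The only risk is clerical (text drift;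
checked by `exact` in the mock).) [doi:10.1088/1361-6544/aaea0a, arXiv:0709.3599, arXiv:1811.00502]
#2 OneDirectionWindowRigidity (crux) — RIGIDITY OF TYPE-I PROFILES INVARIANT ALONG ONE DIRECTION ON
A WINDOW. If v : (−∞,0) × ℝ³ → ℝ³ has the Type-I time rate ‖v(t,x)‖ ≤ C/√(−t), is continuous,
unit-viscosity Oseen-mild between negative times and divergence-free, then (i) every
velocity-gradient slice ∇v(s,·), s < 0, is continuous, and (ii) for every e ≠ 0: if every slice s <
0 carries a nonempty open set on which ∂ₑv(s,y) = 0, then v is not backward-singular at the apex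
(0,0). Proof (tree, p456214 `…LocalSineTubeDoorOneDirectionDoor`): (i) slices are real-analytic;
(ii) already ONE such slice suffices (`oneSliceCrux_dirDerivNorm` / `windowCrux_dirDerivNorm`):
analyticity spreads ∂ₑv(s) = 0 to the slice, the slice is translation-invariant along e,
`eq_zero_of_translate_eq_slice` gives v ≡ 0. [difficulty: S] (why it might fail: it cannot — (ii) is
the tree theorem `windowCrux_dirDerivNorm` (after `norm_eq_zero`), (i) is `(analyticOnNhd_slice
…).contDiff.continuous_fderiv`; the closer is checked in
s13-onedirection-birth/MockS13WithClosers.lean (farm rc 0).) [arXiv:0709.3599,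
doi:10.1088/1361-6544/aaea0a, arXiv:1811.00502]
#3 LocalPointZoomVelGradSlices (crux) — LOCAL POINT ZOOM LIMIT WITH VELOCITY AND GRADIENT SLICES.
For a classical NS solution on [0,T) (Leray–Hopf, rapidly decaying datum) that is locally Type I at
(x₀,T) on one parabolic cylinder of radius ρ but NOT backward bounded at (x₀,T), there are C, a
profile v and a sequence λ_j → 0⁺ such that v has the Type-I time rate, is continuous on (−∞,0) ×
ℝ³, satisfies the unit-viscosity Oseen–Duhamel identity between any two negative times, is
divergence-free, is backward-singular at the apex (0,0), and for EVERY s < 0 and every y the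
rescaled velocities (λ_j/ν)·u(T + λ_j² s/ν, x₀ + λ_j y) converge to v(s, y) AND the rescaled
gradients (λ_j²/ν)·∇u(T + λ_j² s/ν, x₀ + λ_j y) converge to ∇v(s)(y) in operator norm. (= the tree
theorem `…Theorems.LocalSineTubeDoorLocalPointZoomGradSlices.localPointZoomVelGradSlices`, p441522,
verbatim — the universal first-order zoom of the door family.) [difficulty: S] (why it might fail:
it cannot — the statement is the tree theorem `localPointZoomVelGradSlices` (p441522, universal
first-order zoom; locally uniform interior upgrade of the Albritton–Barker/Seregin ancient limit);
closes by `unfold; exact`.) [arXiv:1811.00502, arXiv:0709.3599, Seregin2014]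

TWO-LAYER PLAN. No split foreseen: both cruxes are tree theorems (K1 = p441522; K2 = p456214 + slice
analyticity), closed at birth by the one-liners of
HOME/ns-regularity-ideate-p6/s13-onedirection-birth/MockS13WithClosers.lean (`k1_proof`, `k2_proof`,
`assembly_proof := fun h₁ h₂ => closes h₁ h₂`, `target_proof := closes k1_proof k2_proof`, plus the
glue-independent certificate `target_proof_direct := localTubeDoorOneDirection`). If the gate's
render reorders binders, the closers become `by intro …; exact …` — no new mathematics.

KILL CRITERIA. A refutation of OneDirectionWindowRigidity AS TYPED contradicts the tree theorem
p456214 (kernel-checked, axioms standard) — impossible unless the profile class is mis-rendered by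
the gate (then re-type, not pivot). A refutation of LocalPointZoomVelGradSlices as typed contradicts
p441522 likewise. Proved elsewhere that moots it: the leaf itself is the tree theorem p456214 — the
route is a REGISTRATION of a proved rung (its sequential / most-times strengthenings
`sequentialOneDirectionDoor`, `mostTimesOneDirectionDoor` are also in the tree); local Type-I
exclusion (hard core) would make the leaf vacuous-true; Clay (A) moots everything.

NOT DECOMPOSED YET. Nothing to decompose: the four obligations are one-liners against tree theorems.
The one-slice profile Liouville theorem and the sparse-time doors (p456214) and the
velocity-direction companions (p461138) are by-products already in the tree, not items of this
route.

CHEAPEST FALSIFIER. In-Lean (ran, kernel): `MockS13WithClosers.lean`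
(HOME/ns-regularity-ideate-p6/s13-onedirection-birth/, farm rc 0 / 0 sorries) closes K1, K2,
Assembly and Target against a byte-identical mock of this file — so a refuter must break the gate
render, not the mathematics. Mathematical test of K2 (one slice!): an explicit Type-I ancient mild
profile with one translation-invariant slice would need a non-trivial bounded ancient planar (2½-D)
mild solution with the Type-I rate — excluded by KNSS 2009 Thm 5.1 + Rem. 6.1 + the caloric
Liouville theorem (tree `KNSS2009_typeI_rate_liouville_holds`). Lookup (ran): the printed
one-direction criteria (Kukavica–Ziane 2007, Cao–Titi 2011, Kukavica–Rusin–Ziane 2019 local) are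
integrability conditions on ∂₃u over D; none refutes or contains the leaf.

NUMBERS. No thresholds: the leaf is qualitative and scale-invariant (window U of any size anywhere;
fading = o(1) in L¹(U) of the dimensionless (T−t)∂ₑu; local Type-I constant M arbitrary; e ≠ 0
arbitrary). Printed comparator with numbers: Kukavica–Rusin–Ziane 2019 needs ∂₃u ∈ L^p_tL^q_x(D)
with 2/p + 3/q = 2, 9/4 ≤ q ≤ 5/2 on the WHOLE parabolic domain D (an integrability exponent
condition, no Type I); ours is an o(1) condition on the similarity tube x₀ + √(T−t)U, whose
parabolic measure fraction in any D ∋ (x₀,T) tends to 0, under local Type I — neither implies the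
other. BC9 (ladder ceiling, for the tribunal): method_family = blow-up zoom + translation-symmetry
propagation + ancient planar Liouville with the Type-I rate; ceiling in print = KNSS 2009 Thms
5.1/6.2 (planar / with rate) — the translation-invariant stratum is exactly the planar class, so the
ladder reaches this leaf uncapped; one rung above sit the poloidal stratum (PoloidalWindowDoor, K2
open), the Frobenius stratum (S11, K2⁗ open) and the hard core (L) TypeIliouvilleL (stmt-10661),
none claimed.

DEFINITION REQUESTS. None: IsClassicalNSSolutionOn, IsLerayHopfOn, HasRapidSpatialDecay,
IsBackwardBoundedAt, IsBackwardSingularPoint, HasTypeITimeDecay, heatExtension, oseenDuhamel,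
VectorCalculus.IsDivFree, fderiv, ENNReal.ofReal, MeasureTheory.lintegral all exist (the four item
texts elaborate in MockS13.lean, farm rc 0). Leaf registration request (D-0061, LIST 3):
`Summit.NavierStokesRegularity.NavierStokesRegularity.Theses.LocalOneDirectionTubeDoor.Target` as
rung leaf N0-LocalTubeDoorOneDirection (label LocalTubeDoorOneDirection; PATH (ii): the born item
decl is the door) — director's MINT, not this seat's.

Novelty: Searches (2026-08-26 16:00–18:40Z, nsreg-p6 g5 + ref2 SCORE-p6-10 C5; corpus + galaxy + remote):
`lit search --hybrid "one direction derivative regularity criterion Navier-Stokes ∂3 u"` →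
[corpus:book:robinson2016], [corpus:book:seregin2014] generic; `lit galaxy search "one
direction|regularity in one direction|vertical derivative" --star all` → null for NS criteria;
remote: Kukavica–Ziane 2007 (J. Math. Phys. 48), Cao–Titi 2011 (Arch. Ration. Mech. Anal. 202),
Kukavica–Rusin–Ziane 2019 doi:10.1088/1361-6544/aaea0a (LOCAL, quoted at arXiv:2002.02152 p.6, held)
— supplied by ref2 C5.
Nearest prior art found: Kukavica–Rusin–Ziane 2019 (LOCAL ∂₃u ∈ L^p_tL^q_x(D) ⇒ Hölder regular in D,
suitable weak solutions); Kukavica–Ziane 2007 / Cao–Titi 2011 (GLOBAL one-direction / one-entry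
criteria); tree routes LocalSineTubeDoor / LocalVelCompTubeDoor (same frame and profile class,
direction / component hypotheses); tree p433678 (one-slice translation invariance ⇒ trivial).
Delta: the hypothesis is the L¹-FADING of the SCALE-INVARIANT directional derivative (T−t)∂ₑu over
ONE similarity window of arbitrary placement (a vanishing parabolic fraction of D; an o(1)
condition, not an exponent condition; along sparse times in the tree's sequential/most-times forms),
PLUS local Type I at x₀ (KRZ19 needs none); the mechanism is blow-up + one-slice symmetry Liouville,
not ε-regularity; neither hypothesis implies the other.
Claimed grade: new-combination  [refs: 10.1088/1361-6544/aaea0a, 2002.02152, book:robinson2016, book:seregin2014, doi:10.1088/1361-6544/aaea0a]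

Barriers (technique_class: one-direction-derivative, zoom-compactness, planar-liouville): - technique_class: one-direction-derivative, translation-symmetry-stratum, blow-up-zoom-compactness,
planar-liouville, real-analyticity, type-I-criterion
- Literature.Barriers.NavierStokesRegularity.AveragedTypeIBlowup: OUTSIDE its class — the barrier
blocks Type-I EXCLUSION by averaging-insensitive arguments; the leaf is a CRITERION whose engine is
symmetry propagation by bounded-mild uniqueness + real analyticity of the exact Oseen-mild class and
KNSS's planar Liouville theorem for the genuine bilinear form — Tao's averaged bilinear form has no
such structure; no claim is made about all frame solutions.
- Literature.Barriers.NavierStokesRegularity.TaoAveragedBlowup: same placement (mechanism not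
expressible for the averaged equation; the route does not assert regularity of every solution).
- Literature.Barriers.NavierStokesRegularity.HyperdissipativeAveragedBlowup: same family, same
placement.
- Literature.Barriers.NavierStokesRegularity.EnergySupercriticality: the added hypotheses are
scale-invariant (local Type I; the faded quantity (T−t)∂ₑu on similarity windows is dimensionless),
so the criterion lives at critical scaling and does not pretend to control a supercritical quantity
from the energy class.
- Literature.Barriers.NavierStokesRegularity.LeraySelfSimilarBlowupExclusion: consistent — nothing
in the line needs a self-similar blow-up to exist; a self-similar translation-invariant profile is
excluded twice (Tsai; K2).
- Literature.Barriers.NavierStokesRegularity.Near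

History (route lifecycle, newest last):
- 2026-08-27T06:07:29Z · closes_target -> closes rung N0-LocalTubeDoorOneDirection of NavierStokesRegularity: Summit.NavierStokesRegularity.NavierStokesRegularity.Theses.LocalOneDirectionTubeDoor.Target (D-0061; not the summit Statement) (planner-director-ns-g7-0)
- 2026-08-27T06:20:24Z · CLOSED proved — proved:Summit.NavierStokesRegularity.NavierStokesRegularity.Theorems.LocalOneDirectionTubeDoorTarget.target_proof_direct (planner-director-ns-g7-0)

sub-problem: NavierStokesRegularity · status: closed(proved) · opened planner-director-ns-g7-0 2026-08-27T05:24:50Z · rev 2 · ledger route-NavierStokesRegularity-LocalOneDirectionTubeDoor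
GENERATED by the gate from the ledger (D-0016/17). Provers cite these decls: `theorem foo : Summit.NavierStokesRegularity.NavierStokesRegularity.Theses.LocalOneDirectionTubeDoor.<Decl> := …` in Summits/NavierStokesRegularity/NavierStokesRegularity/Theorems/<Name>.lean.
-/

namespace Summit.NavierStokesRegularity.NavierStokesRegularity.Theses.LocalOneDirectionTubeDoor

open scoped BigOperators Topology Manifold Classical MeasureTheory ProbabilityTheory Matrix InnerProductSpace ComplexConjugate ContinuousMap
open Filter Set Function TopologicalSpace MeasureTheory

attribute [summit_statement] _root_.NavierStokesRegularity
-- H21.Audit: the closer leaf Summit.NavierStokesRegularity.NavierStokesRegularity.Theses.LocalOneDirectionTubeDoor.Target is an item decl of this route file — tagged summit_statement below, after its declaration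

open Literature.NS

/-- item stmt-NavierStokesRegularity-20265 · crux · rank 2 · closed · proved by Summit.NavierStokesRegularity.NavierStokesRegularity.Theorems.LocalOneDirectionTubeDoorOneDirectionWindowRigidityClose.oneDirectionWindowRigidity_proof (prover) · by planner
why it might fail: it cannot — (ii) is the tree theorem `windowCrux_dirDerivNorm` (after `norm_eq_zero`), (i) is `(analyticOnNhd_slice …).contDiff.continuous_fderiv`; the closer is checked in s13-onedirection-birth/MockS13WithClosers.lean (farm rc 0).
sources: arXiv:0709.3599, doi:10.1088/1361-6544/aaea0a, arXiv:1811.00502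
[crux] RIGIDITY OF TYPE-I PROFILES INVARIANT ALONG ONE DIRECTION ON A WINDOW. If v : (−∞,0) × ℝ³ →
ℝ³ has the Type-I time rate ‖v(t,x)‖ ≤ C/√(−t), is continuous, unit-viscosity Oseen-mild between
negative times and divergence-free, then (i) every velocity-gradient slice ∇v(s,·), s < 0, is
continuous, and (ii) for every e ≠ 0: if every slice s < 0 carries a nonempty open set on which
∂ₑv(s,y) = 0, then v is not backward-singular at the apex (0,0). Proof (tree, p456214
`…LocalSineTubeDoorOneDirectionDoor`): (i) slices are real-analytic; (ii) already ONE such slice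
suffices (`oneSliceCrux_dirDerivNorm` / `windowCrux_dirDerivNorm`): analyticity spreads ∂ₑv(s) = 0
to the slice, the slice is translation-invariant along e, `eq_zero_of_translate_eq_slice` gives v ≡
0. [difficulty: S] -/
@[route_item "route-NavierStokesRegularity-LocalOneDirectionTubeDoor", crux]
def OneDirectionWindowRigidity : Prop :=
  ∀ (C : ℝ) (v : ℝ → EuclideanSpace ℝ (Fin 3) → EuclideanSpace ℝ (Fin 3)), Literature.Analysis.FluidPDE.HasTypeITimeDecay C v → ContinuousOn (Function.uncurry v) (Set.Iio (0 : ℝ) ×ˢ Set.univ) → (∀ s t : ℝ, s < t → t < 0 → ∀ x, v t x = Literature.Analysis.UnboundedOperators.heatExtension (v s) (t - s) x - Literature.Analysis.FluidPDE.oseenDuhamel 1 s v v t x) → (∀ t < 0, Literature.Analysis.FluidPDE.VectorCalculus.IsDivFree (v t)) → (∀ s < 0, Continuous (fderiv ℝ (v s))) ∧ ∀ (e : EuclideanSpace ℝ (Fin 3)), e ≠ 0 → (∀ s < 0, ∃ U : Set (EuclideanSpace ℝ (Fin 3)), IsOpen U ∧ U.Nonempty ∧ ∀ y ∈ U, fderiv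 ℝ (v s) y e = 0) → ¬ Literature.Analysis.FluidPDE.IsBackwardSingularPoint v 0

-- `OneDirectionWindowRigidity` holds: proved by `Summit.NavierStokesRegularity.NavierStokesRegularity.Theorems.LocalOneDirectionTubeDoorOneDirectionWindowRigidityClose.oneDirectionWindowRigidity_proof` (its module imports this route file, so no `_holds` link can be stated here).

/-- item stmt-NavierStokesRegularity-20266 · crux · rank 3 · closed · proved by Summit.NavierStokesRegularity.NavierStokesRegularity.Theorems.LocalOneDirectionTubeDoorLocalPointZoomVelGradSlicesClose.localPointZoomVelGradSlices_proof (prover) · by planner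
why it might fail: it cannot — the statement is the tree theorem `localPointZoomVelGradSlices` (p441522, universal first-order zoom; locally uniform interior upgrade of the Albritton–Barker/Seregin ancient limit); closes by `unfold; exact`.
sources: arXiv:1811.00502, arXiv:0709.3599, Seregin2014
[crux] LOCAL POINT ZOOM LIMIT WITH VELOCITY AND GRADIENT SLICES. For a classical NS solution on
[0,T) (Leray–Hopf, rapidly decaying datum) that is locally Type I at (x₀,T) on one parabolic
cylinder of radius ρ but NOT backward bounded at (x₀,T), there are C, a profile v and a sequence λ_j
→ 0⁺ such that v has the Type-I time rate, is continuous on (−∞,0) × ℝ³, satisfies the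
unit-viscosity Oseen–Duhamel identity between any two negative times, is divergence-free, is
backward-singular at the apex (0,0), and for EVERY s < 0 and every y the rescaled velocities
(λ_j/ν)·u(T + λ_j² s/ν, x₀ + λ_j y) converge to v(s, y) AND the rescaled gradients (λ_j²/ν)·∇u(T +
λ_j² s/ν, x₀ + λ_j y) converge to ∇v(s)(y) in operator norm. (= the tree theorem
`…Theorems.LocalSineTubeDoorLocalPointZoomGradSlices.localPointZoomVelGradSlices`, p441522, verbatim
— the universal first-order zoom of the door family.) [difficulty: S] -/
@[route_item "route-NavierStokesRegularity-LocalOneDirectionTubeDoor", crux]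
def LocalPointZoomVelGradSlices : Prop :=
  ∀ (ν T : ℝ), 0 < ν → 0 < T → ∀ (u : ℝ → EuclideanSpace ℝ (Fin 3) → EuclideanSpace ℝ (Fin 3)) (p : ℝ → EuclideanSpace ℝ (Fin 3) → ℝ), Literature.Analysis.FluidPDE.IsClassicalNSSolutionOn (Set.Ico 0 T) ν 0 u p → Literature.Analysis.FluidPDE.IsLerayHopfOn T ν 0 (u 0) u → Literature.Analysis.FluidPDE.HasRapidSpatialDecay (u 0) → ∀ (x₀ : EuclideanSpace ℝ (Fin 3)) (ρ M : ℝ), 0 < ρ → (∀ t ∈ Set.Ico 0 T, T - ρ ^ 2 < t → ∀ x ∈ Metric.ball x₀ ρ, ‖u t x‖ * Real.sqrt (ν * (T - t)) ≤ M) → ¬ Literature.Analysis.FluidPDE.IsBackwardBoundedAt u T x₀ → ∃ (C : ℝ) (v : ℝ → EuclideanSpace ℝ (Fin 3) → EuclideanSpace ℝ (Fin 3)) (lam : ℕ → ℝ), (∀ j, 0 < lam j) ∧ Filter.Tendsto lam Filter.atTop (nhds 0) ∧ (Literature.Analysis.FluidPDE.HasTypeITimeDecay C v ∧ ContinuousOn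 (Function.uncurry v) (Set.Iio (0 : ℝ) ×ˢ Set.univ) ∧ (∀ s t : ℝ, s < t → t < 0 → ∀ x, v t x = Literature.Analysis.UnboundedOperators.heatExtension (v s) (t - s) x - Literature.Analysis.FluidPDE.oseenDuhamel 1 s v v t x) ∧ (∀ t < 0, Literature.Analysis.FluidPDE.VectorCalculus.IsDivFree (v t))) ∧ Literature.Analysis.FluidPDE.IsBackwardSingularPoint v 0 ∧ ∀ s < 0, ∀ y, Filter.Tendsto (fun j => (lam j / ν) • u (T + lam j ^ 2 * s / ν) (x₀ + lam j • y)) Filter.atTop (nhds (v s y)) ∧ Filter.Tendsto (fun j => (lam j ^ 2 / ν) • fderiv ℝ (u (T + lam j ^ 2 * s / ν)) (x₀ + lam j • y)) Filter.atTop (nhds (fderiv ℝ (v s) y))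

-- `LocalPointZoomVelGradSlices` holds: proved by `Summit.NavierStokesRegularity.NavierStokesRegularity.Theorems.LocalOneDirectionTubeDoorLocalPointZoomVelGradSlicesClose.localPointZoomVelGradSlices_proof` (its module imports this route file, so no `_holds` link can be stated here).

/-- item stmt-NavierStokesRegularity-20264 · aside · rank 0 · closed · proved by Summit.NavierStokesRegularity.NavierStokesRegularity.Theorems.LocalOneDirectionTubeDoorTarget.target_proof_direct (prover) · by planner
why it might fail: it cannot — the statement is the tree theorem `localTubeDoorOneDirection` (p456214); the route records it as a rung leaf with its two cruxes by name. The only risk is clerical (text drift; checked by `exact` in the mock).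
sources: doi:10.1088/1361-6544/aaea0a, arXiv:0709.3599, arXiv:1811.00502
[target] the leaf LocalTubeDoorOneDirection: classical NS solution on [0,T), Leray–Hopf from a
rapidly decaying datum, locally Type I at (x₀,T) on B(x₀,ρ) × ((T−ρ²)∨0, T); if for ONE fixed e ≠ 0
and ONE nonempty open window U of similarity coordinates the scale-normalised directional derivative
fades in L¹, ∫_U (T−t) ‖∂ₑu(t, x₀+√(T−t)y)‖ dy → 0 as t → T⁻, then u is backward bounded at (x₀,T).
(= statement of the tree theorem
`…Theorems.LocalSineTubeDoorOneDirectionDoor.localTubeDoorOneDirection`, p456214, verbatim.) -/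
@[route_item "route-NavierStokesRegularity-LocalOneDirectionTubeDoor"]
def Target : Prop :=
  ∀ (ν T : ℝ), 0 < ν → 0 < T → ∀ (u : ℝ → EuclideanSpace ℝ (Fin 3) → EuclideanSpace ℝ (Fin 3)) (p : ℝ → EuclideanSpace ℝ (Fin 3) → ℝ), Literature.Analysis.FluidPDE.IsClassicalNSSolutionOn (Set.Ico 0 T) ν 0 u p → Literature.Analysis.FluidPDE.IsLerayHopfOn T ν 0 (u 0) u → Literature.Analysis.FluidPDE.HasRapidSpatialDecay (u 0) → ∀ (x₀ : EuclideanSpace ℝ (Fin 3)) (ρ M : ℝ), 0 < ρ → (∀ t ∈ Set.Ico 0 T, T - ρ ^ 2 < t → ∀ x ∈ Metric.ball x₀ ρ, ‖u t x‖ * Real.sqrt (ν * (T - t)) ≤ M) → ∀ (e : EuclideanSpace ℝ (Fin 3)), e ≠ 0 → ∀ (U : Set (EuclideanSpace ℝ (Fin 3))), IsOpen U → U.Nonempty → Filter.Tendsto (fun t => ∫⁻ y in U, ENNReal.ofReal ((T - t) * ‖fderiv ℝ (u t) (x₀ + Real.sqrt (T - t) • y) e‖)) (nhdsWithin T (Set.Iio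 T)) (nhds 0) → Literature.Analysis.FluidPDE.IsBackwardBoundedAt u T x₀

-- `Target` holds: proved by `Summit.NavierStokesRegularity.NavierStokesRegularity.Theorems.LocalOneDirectionTubeDoorTarget.target_proof_direct` (its module imports this route file, so no `_holds` link can be stated here).

/-- item stmt-NavierStokesRegularity-20267 · assembly · rank 1 · closed · proved by Summit.NavierStokesRegularity.NavierStokesRegularity.Theorems.LocalOneDirectionTubeDoorAssembly.assembly_proof (prover) · by planner
sources: arXiv:1811.00502, arXiv:0709.3599
[assembly] LocalPointZoomVelGradSlices → OneDirectionWindowRigidity → the leaf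
LocalTubeDoorOneDirection (Target). -/
@[route_item "route-NavierStokesRegularity-LocalOneDirectionTubeDoor"]
def Assembly : Prop :=
  LocalPointZoomVelGradSlices → OneDirectionWindowRigidity → Target

-- `Assembly` holds: proved by `Summit.NavierStokesRegularity.NavierStokesRegularity.Theorems.LocalOneDirectionTubeDoorAssembly.assembly_proof` (its module imports this route file, so no `_holds` link can be stated here).

attribute [summit_statement] _root_.Summit.NavierStokesRegularity.NavierStokesRegularity.Theses.LocalOneDirectionTubeDoor.Target

/-! D-0027 §2.1 — DECIDING THEOREM (planner-authored via `route open/edit --closes-file`; by planner-director-ns-g7-0 2026-08-27T06:07:29Z) — ARCHIVED: route closed (proved) 2026-08-27T06:20:23Z; kept so importers keep building: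
its hypotheses are this route's items and its conclusion the registered leaf `Summit.NavierStokesRegularity.NavierStokesRegularity.Theses.LocalOneDirectionTubeDoor.Target` (rung N0-LocalTubeDoorOneDirection, D-0061) (glue_lint), and it elaborates with this file. -/

/-- DECIDING THEOREM (self-contained: zoom bookkeeping + Fatou on `∫⁻` + a.e.-to-everywhere on an open window; rigidity from K2). -/
@[closes "route-NavierStokesRegularity-LocalOneDirectionTubeDoor"] theorem closes (h₁ : LocalPointZoomVelGradSlices) (h₂ : OneDirectionWindowRigidity) : Target := by
  intro ν T hν hT u p hcl hLH hdec x₀ ρ M hρ hM e he U hU hUne hfade0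
  by_contra hnot
  obtain ⟨C, v, lam, hlam, hlam0, ⟨hrate, hcont, hmild, hdiv⟩, hsing, hconv⟩ :=
    h₁ ν T hν hT u p hcl hLH hdec x₀ ρ M hρ hM hnot
  obtain ⟨hDslice, hrig0⟩ := h₂ C v hrate hcont hmild hdiv
  have hrig := hrig0 e he
  obtain ⟨F, hFdef⟩ : ∃ F : EuclideanSpace ℝ (Fin 3) → (EuclideanSpace ℝ (Fin 3) →L[ℝ] EuclideanSpace ℝ (Fin 3)) → ℝ,
      ∀ x A, F x A = ‖A e‖ := ⟨fun _ A => ‖A e‖, fun _ _ => rfl⟩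
  have hF : Continuous fun q : EuclideanSpace ℝ (Fin 3) × (EuclideanSpace ℝ (Fin 3) →L[ℝ] EuclideanSpace ℝ (Fin 3)) =>
      F q.1 q.2 := by
    have e' : (fun q : EuclideanSpace ℝ (Fin 3) × (EuclideanSpace ℝ (Fin 3) →L[ℝ] EuclideanSpace ℝ (Fin 3)) => F q.1 q.2) =
        fun q => ‖q.2 e‖ := funext fun q => hFdef q.1 q.2
    rw [e']
    exact continuous_norm.comp ((ContinuousLinearMap.apply ℝ (EuclideanSpace ℝ (Fin 3)) e).continuous.comp continuous_snd)
  have hfade : Tendsto (fun t => ∫⁻ y in U, ENNReal.ofReal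
      |F (Real.sqrt (T - t) • u t (x₀ + Real.sqrt (T - t) • y))
        (Real.sqrt (T - t) ^ 2 • fderiv ℝ (u t) (x₀ + Real.sqrt (T - t) • y))|) (𝓝[<] T) (𝓝 0) := by
    have hevT : ∀ᶠ t in nhdsWithin T (Set.Iio T), t < T := eventually_nhdsWithin_of_forall fun t ht => ht
    refine hfade0.congr' (hevT.mono fun t ht => ?_)
    refine lintegral_congr fun y => ?_
    have hs' : 0 ≤ T - t := (sub_pos.2 ht).le
    rw [hFdef, _root_.smul_apply, norm_smul, Real.sq_sqrt hs', Real.norm_eq_abs, abs_of_nonneg hs',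
      abs_of_nonneg (mul_nonneg hs' (norm_nonneg _))]
  have key : ∀ s < 0, ∀ y ∈ U, F ((Real.sqrt (-s) / Real.sqrt ν * ν) • v s ((Real.sqrt (-s) / Real.sqrt ν) • y))
      (((Real.sqrt (-s) / Real.sqrt ν) ^ 2 * ν) • fderiv ℝ (v s) ((Real.sqrt (-s) / Real.sqrt ν) • y)) = 0 := by
    intro s hs y hy
    have hns : 0 < -s := neg_pos.2 hs
    obtain ⟨t, ht⟩ : ∃ t : ℕ → ℝ, ∀ j, t j = T + lam j ^ 2 * s / ν := ⟨_, fun j => rfl⟩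
    have hTt : ∀ j, T - t j = lam j ^ 2 * (-s) / ν := fun j => by rw [ht j]; ring
    have hc : ∀ j, 0 < lam j ^ 2 * (-s) / ν := fun j => div_pos (mul_pos (pow_pos (hlam j) 2) hns) hν
    have hc0 : Tendsto (fun j => lam j ^ 2 * (-s) / ν) atTop (𝓝 0) := by
      simpa using ((hlam0.pow 2).mul_const (-s)).div_const ν
    have htT : Tendsto t atTop (𝓝[<] T) := by
      refine tendsto_nhdsWithin_iff.2 ⟨?_, Eventually.of_forall fun j => ?_⟩
      · have h1 : Tendsto (fun j => T - lam j ^ 2 * (-s) / ν) atTop (𝓝 (T - 0)) :=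
          tendsto_const_nhds.sub hc0
        rw [sub_zero] at h1
        refine h1.congr fun j => ?_
        rw [ht j]; ring
      · show t j < T
        have h1 := hc j
        rw [← hTt j] at h1
        linarith
    have hev : ∀ᶠ j in atTop, t j ∈ Set.Ioo 0 T := htT.eventually (Ioo_mem_nhdsLT hT)
    obtain ⟨j₀, hj₀⟩ := eventually_atTop.1 hev
    have hshift : Tendsto (fun j : ℕ => j + j₀) atTop atTop := tendsto_add_atTop_nat j₀
    have hfadej : Tendsto (fun j => ∫⁻ y in U, ENNReal.ofReal
        |F (Real.sqrt (T - t (j + j₀)) • u (t (j + j₀)) (x₀ + Real.sqrt (T - t (j + j₀)) • y))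
          (Real.sqrt (T - t (j + j₀)) ^ 2 • fderiv ℝ (u (t (j + j₀))) (x₀ + Real.sqrt (T - t (j + j₀)) • y))|)
        atTop (𝓝 0) := (hfade.comp htT).comp hshift
    set σ : ℝ := Real.sqrt (-s) / Real.sqrt ν with hσ
    have hσpos : 0 < σ := div_pos (Real.sqrt_pos.2 hns) (Real.sqrt_pos.2 hν)
    have hsq : ∀ j, Real.sqrt (T - t j) = lam j * σ := by
      intro j
      rw [hTt j, hσ, Real.sqrt_div' _ hν.le, Real.sqrt_mul (pow_nonneg (hlam j).le 2),
        Real.sqrt_sq (hlam j).le]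
      ring
    set W : ℕ → EuclideanSpace ℝ (Fin 3) → EuclideanSpace ℝ (Fin 3) := fun j y =>
      Real.sqrt (T - t (j + j₀)) • u (t (j + j₀)) (x₀ + Real.sqrt (T - t (j + j₀)) • y) with hWdef
    have hW : ∀ (j : ℕ) (y : EuclideanSpace ℝ (Fin 3)), W j y =
        (σ * ν) • ((lam (j + j₀) / ν) • u (T + lam (j + j₀) ^ 2 * s / ν)
          (x₀ + lam (j + j₀) • (σ • y))) := by
      intro j y
      simp only [hWdef, hsq (j + j₀), smul_smul]
      rw [ht (j + j₀)]
      congr 1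
      field_simp
    set G : ℕ → EuclideanSpace ℝ (Fin 3) → (EuclideanSpace ℝ (Fin 3) →L[ℝ] EuclideanSpace ℝ (Fin 3)) := fun j y =>
      Real.sqrt (T - t (j + j₀)) ^ 2 • fderiv ℝ (u (t (j + j₀))) (x₀ + Real.sqrt (T - t (j + j₀)) • y) with hGdef
    have hG : ∀ (j : ℕ) (y : EuclideanSpace ℝ (Fin 3)), G j y =
        (σ ^ 2 * ν) • ((lam (j + j₀) ^ 2 / ν) • fderiv ℝ (u (T + lam (j + j₀) ^ 2 * s / ν))
          (x₀ + lam (j + j₀) • (σ • y))) := by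
      intro j y
      simp only [hGdef, hsq (j + j₀), smul_smul]
      rw [ht (j + j₀)]
      congr 1
      field_simp
    set Hs : EuclideanSpace ℝ (Fin 3) → ℝ := fun y =>
      F ((σ * ν) • v s (σ • y)) ((σ ^ 2 * ν) • fderiv ℝ (v s) (σ • y)) with hHsdef
    have hDs : Continuous (fderiv ℝ (v s)) := hDslice s hs
    have hHscont : Continuous Hs := by
      have e' : Hs = fun y => ‖(((σ ^ 2 * ν) • fderiv ℝ (v s) (σ • y))) e‖ := by
        funext y
        simp only [hHsdef]
        rw [hFdef]
      rw [e']
      have h2 : Continuous fun y : EuclideanSpace ℝ (Fin 3) => (σ ^ 2 * ν) • fderiv ℝ (v s) (σ • y) :=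
        (hDs.comp (continuous_const_smul σ)).const_smul (σ ^ 2 * ν)
      exact continuous_norm.comp (h2.clm_apply continuous_const)
    have hconvW : ∀ y, Tendsto (fun j => W j y) atTop (𝓝 ((σ * ν) • v s (σ • y))) := by
      intro y
      have h := (((hconv s hs (σ • y)).1).comp hshift).const_smul (σ * ν)
      exact h.congr fun j => (hW j y).symm
    have hconvG : ∀ y, Tendsto (fun j => G j y) atTop (𝓝 ((σ ^ 2 * ν) • fderiv ℝ (v s) (σ • y))) := by
      intro y
      have h := (((hconv s hs (σ • y)).2).comp hshift).const_smul (σ ^ 2 * ν)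
      exact h.congr fun j => (hG j y).symm
    have hconvH : ∀ y, Tendsto (fun j => F (W j y) (G j y)) atTop (𝓝 (Hs y)) := fun y =>
      (hF.tendsto _).comp ((hconvW y).prodMk_nhds (hconvG y))
    have hmem : ∀ j, t (j + j₀) ∈ Set.Ico 0 T := fun j =>
      ⟨(hj₀ (j + j₀) (Nat.le_add_left _ _)).1.le, (hj₀ (j + j₀) (Nat.le_add_left _ _)).2⟩
    have hφ : ∀ j, Continuous fun y : EuclideanSpace ℝ (Fin 3) => x₀ + Real.sqrt (T - t (j + j₀)) • y :=
      fun j => continuous_const.add (continuous_const_smul _)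
    have hWc : ∀ j, Continuous (W j) := fun j => by
      show Continuous fun y => Real.sqrt (T - t (j + j₀)) • u (t (j + j₀)) (x₀ + Real.sqrt (T - t (j + j₀)) • y)
      exact ((hcl.contDiff_velocity (hmem j)).continuous.comp (hφ j)).const_smul (Real.sqrt (T - t (j + j₀)))
    have hGc : ∀ j, Continuous (G j) := fun j => by
      show Continuous fun y =>
        Real.sqrt (T - t (j + j₀)) ^ 2 • fderiv ℝ (u (t (j + j₀))) (x₀ + Real.sqrt (T - t (j + j₀)) • y)
      exact (((hcl.contDiff_velocity (hmem j)).continuous_fderiv (by norm_cast)).comp (hφ j)).const_smul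
        (Real.sqrt (T - t (j + j₀)) ^ 2)
    have hFjc : ∀ j, Continuous fun y => F (W j y) (G j y) := fun j => hF.comp ((hWc j).prodMk (hGc j))
    set g : EuclideanSpace ℝ (Fin 3) → ENNReal := fun y => ENNReal.ofReal |Hs y| with hg
    have hgc : Continuous g := ENNReal.continuous_ofReal.comp (continuous_abs.comp hHscont)
    have hgjm : ∀ j, Measurable fun y => ENNReal.ofReal |F (W j y) (G j y)| :=
      fun j => (ENNReal.continuous_ofReal.comp (continuous_abs.comp (hFjc j))).measurable
    have hptw : ∀ y, Tendsto (fun j => ENNReal.ofReal |F (W j y) (G j y)|) atTop (𝓝 (g y)) :=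
      fun y => ENNReal.tendsto_ofReal ((continuous_abs.tendsto (Hs y)).comp (hconvH y))
    have hFatou : ∫⁻ y in U, liminf (fun j => ENNReal.ofReal |F (W j y) (G j y)|) atTop ≤
        liminf (fun j => ∫⁻ y in U, ENNReal.ofReal |F (W j y) (G j y)|) atTop :=
      lintegral_liminf_le' (fun j => (hgjm j).aemeasurable)
    have hlim : (fun y => liminf (fun j => ENNReal.ofReal |F (W j y) (G j y)|) atTop) = g :=
      funext fun y => (hptw y).liminf_eq
    have hfadeW : Tendsto (fun j => ∫⁻ y in U, ENNReal.ofReal |F (W j y) (G j y)|) atTop (𝓝 0) := hfadej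
    rw [hlim, hfadeW.liminf_eq] at hFatou
    have hint : ∫⁻ y in U, g y = 0 := le_antisymm hFatou bot_le
    have hae : ∀ᵐ y ∂(volume.restrict U), g y = 0 := (lintegral_eq_zero_iff hgc.measurable).1 hint
    rw [ae_restrict_iff' hU.measurableSet] at hae
    have hzero : ∀ y ∈ U, g y = 0 := by
      intro y hy
      by_contra hne
      set O : Set (EuclideanSpace ℝ (Fin 3)) := U ∩ g ⁻¹' (Ioi 0) with hO
      have hOo : IsOpen O := hU.inter (isOpen_Ioi.preimage hgc)
      have hO0 : volume O = 0 := by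
        rw [measure_eq_zero_iff_ae_notMem]
        filter_upwards [hae] with y' hy'
        rintro ⟨h1, h2⟩
        have := hy' h1
        simp only [mem_preimage, mem_Ioi, this, lt_self_iff_false] at h2
      have hOe : O = ∅ := (hOo.measure_eq_zero_iff volume).1 hO0
      have hyO : y ∈ O := ⟨hy, by simpa [mem_preimage, mem_Ioi, pos_iff_ne_zero] using hne⟩
      rw [hOe] at hyO
      exact hyO
    have h := hzero y hy
    simp only [hg, ENNReal.ofReal_eq_zero] at h
    exact abs_eq_zero.1 (le_antisymm h (abs_nonneg _))

  refine hrig (fun s hs => ?_) hsing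
  have hns : 0 < -s := neg_pos.2 hs
  set σ : ℝ := Real.sqrt (-s) / Real.sqrt ν with hσdef
  have hσpos : 0 < σ := div_pos (Real.sqrt_pos.2 hns) (Real.sqrt_pos.2 hν)
  refine ⟨(fun z => σ⁻¹ • z) ⁻¹' U, hU.preimage (continuous_const_smul σ⁻¹), ?_, fun z hz => ?_⟩
  · obtain ⟨u₀, hu₀⟩ := hUne
    refine ⟨σ • u₀, ?_⟩
    show σ⁻¹ • (σ • u₀) ∈ U
    rwa [smul_smul, inv_mul_cancel₀ hσpos.ne', one_smul]
  · have h := key s hs (σ⁻¹ • z) hz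
    rw [← hσdef, smul_smul, mul_inv_cancel₀ hσpos.ne', one_smul] at h
    rw [hFdef, _root_.smul_apply, norm_smul, mul_eq_zero] at h
    rcases h with h0 | h0
    · exfalso
      have : 0 < σ ^ 2 * ν := by positivity
      rw [Real.norm_eq_abs, abs_eq_zero] at h0
      exact this.ne' h0
    · exact norm_eq_zero.1 h0

end Summit.NavierStokesRegularity.NavierStokesRegularity.Theses.LocalOneDirectionTubeDoor
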